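import Summits.CriticalPhenomena.Ising3DConformalLimit.Theorems.CoerciveSharpnessDimensionPinnedPointwiseTransfer
import Summits.CriticalPhenomena.Ising3DConformalLimit.Theorems.PrecisionLaplacianInverseMCriticalKernel
import Summits.CriticalPhenomena.Ising3DConformalLimit.Theses.ClusterRigidity
import Summits.CriticalPhenomena.Ising3DConformalLimit.Theses.HelsonAxis
import Literature.Probability.LatticeModels.PointwiseScalingLimitEtaExists
import HarnessLib

/-!
# Route `CoerciveSharpness`, crux `DimensionPinned` (item stmt-CriticalPhenomena-4662), line `torus-fss-dock`:
# the torus port `TorusUniformDyadicRate → DimensionPinned` (registered stubs `stub_thermodynamicLimit`,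
# `stub_geometricLawRate`; strategist r1)

The FINITE-SIZE-SCALING dock of the crux.  A torus-uniform GEOMETRIC rate for the dyadic ratio of the
periodic critical two-point function along `e₀`,

  `∃ Δ θ C A, 0 < θ < 1, 1 ≤ A, ∀ k, ∀ N + 1 ≥ A·2^{k+1},
      |⟨σ₀σ_{2^{k+1}e₀}⟩_{𝕋_{N+1};β_c(3)} · 4^Δ / ⟨σ₀σ_{2^k e₀}⟩_{𝕋_{N+1};β_c(3)} − 1| ≤ C θ^k`

(the native output format of a certified finite-volume renormalisation: hyperbolic fixed point ⟹ geometric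
corrections to scaling, read on exactly contractible tori; card `tensor-rg-dilatation-certificate`), passes to
the infinite-volume critical two-point function by the tree's thermodynamic limit
`tendsto_isingTorusTwoPoint_criticalTwoPoint` (`m*(β_c) = 0`, Aizenman–Duminil-Copin–Sidoravicius), giving the
pointwise dyadic geometric law `|g(2^{k+1}) 4^Δ / g(2^k) − 1| ≤ C θ^k`; logs of near-one ratios turn it into
the octave-ratio rate `|log g(2^{k+2}) − 2 log g(2^{k+1}) + log g(2^k)| ≤ C' (2^k)^{-θ'}`, `θ' = -log₂ θ`,
which is the hypothesis of the LANDED pointwise port `stub_pointwiseTransfer` (p162779, line `Sketch`).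
Hence `TorusUniformDyadicRate → DimensionPinned` (`dimensionPinned_of_torusUniformDyadicRate`).
No definition, no notation; statements written out over tree declarations.
-/

noncomputable section

namespace Summit.CriticalPhenomena.Ising3DConformalLimit.Theorems.CoerciveSharpnessDimensionPinnedTorusDock

open Filter Topology Finset
open Literature.Probability.LatticeModels
open Summit.CriticalPhenomena.Ising3DConformalLimit.Theses.CoerciveSharpness (DimensionPinned)

/-- `|log r| ≤ 2|r - 1|` for `r ≥ 1/2` (from `1 - 1/r ≤ log r ≤ r - 1`). [folklore] -/
theorem abs_log_le_two_mul_abs_sub_one {r : ℝ} (hr : 1 / 2 ≤ r) : |Real.log r| ≤ 2 * |r - 1| := by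
  have hr0 : 0 < r := by linarith
  rw [abs_le]
  constructor
  · have h1 : 1 - r⁻¹ ≤ Real.log r := Real.one_sub_inv_le_log_of_pos hr0
    have h2 : 1 - r⁻¹ = (r - 1) / r := by field_simp
    have h3 : -(2 * |r - 1|) ≤ (r - 1) / r := by
      rw [le_div_iff₀ hr0]
      nlinarith [mul_nonneg (by linarith : (0:ℝ) ≤ 2 * r - 1) (abs_nonneg (r - 1)), neg_abs_le (r - 1)]
    linarith
  · have h1 := Real.log_le_sub_one_of_pos hr0
    have h2 := le_abs_self (r - 1)
    have h3 := abs_nonneg (r - 1)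
    linarith

/-- **Registered stub `stub_thermodynamicLimit` of line `torus-fss-dock`**: the torus-uniform dyadic rate
passes to the infinite-volume critical two-point function (thermodynamic limit at fixed `k`). -/
theorem stub_thermodynamicLimit :
    (∃ Δ θ C : ℝ, ∃ A : ℕ, 0 < θ ∧ θ < 1 ∧ 1 ≤ A ∧ ∀ k N : ℕ, A * 2 ^ (k + 1) ≤ N + 1 →
      |isingTorusTwoPoint 3 (N + 1) (criticalBeta 3) 0 (Torus.proj (N + 1) 0)
            (Torus.proj (N + 1) (Pi.single 0 ((2 ^ (k + 1) : ℕ) : ℤ))) * (4 : ℝ) ^ Δ /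
          isingTorusTwoPoint 3 (N + 1) (criticalBeta 3) 0 (Torus.proj (N + 1) 0)
            (Torus.proj (N + 1) (Pi.single 0 ((2 ^ k : ℕ) : ℤ))) - 1| ≤ C * θ ^ k) →
    ∃ Δ θ C : ℝ, 0 < θ ∧ θ < 1 ∧ ∀ k : ℕ,
      |criticalTwoPoint 3 (Pi.single 0 ((2 ^ (k + 1) : ℕ) : ℤ)) * (4 : ℝ) ^ Δ /
          criticalTwoPoint 3 (Pi.single 0 ((2 ^ k : ℕ) : ℤ)) - 1| ≤ C * θ ^ k := by
  rintro ⟨Δ, θ, C, A, hθ, hθ1, hA, h⟩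
  refine ⟨Δ, θ, C, hθ, hθ1, fun k => ?_⟩
  have ha := tendsto_isingTorusTwoPoint_criticalTwoPoint (d := 3) le_rfl (0 : Site 3)
    (Pi.single 0 ((2 ^ (k + 1) : ℕ) : ℤ))
  have hb := tendsto_isingTorusTwoPoint_criticalTwoPoint (d := 3) le_rfl (0 : Site 3)
    (Pi.single 0 ((2 ^ k : ℕ) : ℤ))
  rw [sub_zero] at ha hb
  have hbpos : 0 < criticalTwoPoint 3 (Pi.single 0 ((2 ^ k : ℕ) : ℤ)) :=
    criticalTwoPoint_axis_pos (2 ^ k)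
  have hF : Tendsto (fun N : ℕ =>
      |isingTorusTwoPoint 3 (N + 1) (criticalBeta 3) 0 (Torus.proj (N + 1) 0)
            (Torus.proj (N + 1) (Pi.single 0 ((2 ^ (k + 1) : ℕ) : ℤ))) * (4 : ℝ) ^ Δ /
          isingTorusTwoPoint 3 (N + 1) (criticalBeta 3) 0 (Torus.proj (N + 1) 0)
            (Torus.proj (N + 1) (Pi.single 0 ((2 ^ k : ℕ) : ℤ))) - 1|) atTop
      (𝓝 (|criticalTwoPoint 3 (Pi.single 0 ((2 ^ (k + 1) : ℕ) : ℤ)) * (4 : ℝ) ^ Δ /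
          criticalTwoPoint 3 (Pi.single 0 ((2 ^ k : ℕ) : ℤ)) - 1|)) :=
    (((ha.mul_const _).div hb hbpos.ne').sub_const 1).abs
  refine le_of_tendsto hF ?_
  rw [eventually_atTop]
  exact ⟨A * 2 ^ (k + 1), fun N hN => h k N (by omega)⟩

/-- **Registered stub `stub_geometricLawRate` of line `torus-fss-dock`**: a pointwise dyadic GEOMETRIC law
`|g(2^{k+1}) 4^Δ / g(2^k) − 1| ≤ C θ^k` (`0 < θ < 1`) gives the octave-ratio power rate of the second dyadic
differences of `log g`, with exponent `θ' = -log₂ θ`. Pure real analysis. [folklore] -/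
theorem stub_geometricLawRate :
    (∃ Δ θ C : ℝ, 0 < θ ∧ θ < 1 ∧ ∀ k : ℕ,
      |criticalTwoPoint 3 (Pi.single 0 ((2 ^ (k + 1) : ℕ) : ℤ)) * (4 : ℝ) ^ Δ /
          criticalTwoPoint 3 (Pi.single 0 ((2 ^ k : ℕ) : ℤ)) - 1| ≤ C * θ ^ k) →
    ∃ θ C : ℝ, 0 < θ ∧ ∀ k : ℕ,
      |Real.log (criticalTwoPoint 3 (Pi.single 0 ((2 ^ (k + 2) : ℕ) : ℤ))) -
          2 * Real.log (criticalTwoPoint 3 (Pi.single 0 ((2 ^ (k + 1) : ℕ) : ℤ))) +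
        Real.log (criticalTwoPoint 3 (Pi.single 0 ((2 ^ k : ℕ) : ℤ)))| ≤ C * ((2:ℝ) ^ k) ^ (-θ) := by
  rintro ⟨Δ, θ, C, hθ, hθ1, h⟩
  -- the dyadic profile and the normalised ratios
  let g : ℕ → ℝ := fun k => criticalTwoPoint 3 (Pi.single 0 ((2 ^ k : ℕ) : ℤ))
  have hgpos : ∀ k, 0 < g k := fun k => criticalTwoPoint_axis_pos (2 ^ k)
  have h4 : (0 : ℝ) < (4 : ℝ) ^ Δ := Real.rpow_pos_of_pos (by norm_num) Δ
  let r : ℕ → ℝ := fun k => g (k + 1) * (4 : ℝ) ^ Δ / g k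
  have hr : ∀ k, |r k - 1| ≤ C * θ ^ k := fun k => h k
  have hrpos : ∀ k, 0 < r k := fun k => div_pos (mul_pos (hgpos _) h4) (hgpos _)
  have hlogr : ∀ k, Real.log (r k) = Real.log (g (k + 1)) + Δ * Real.log 4 - Real.log (g k) := by
    intro k
    show Real.log (g (k + 1) * (4 : ℝ) ^ Δ / g k) = _
    rw [Real.log_div (mul_pos (hgpos _) h4).ne' (hgpos k).ne', Real.log_mul (hgpos _).ne' h4.ne',
      Real.log_rpow (by norm_num : (0:ℝ) < 4)]
  have hsd : ∀ k, Real.log (g (k + 2)) - 2 * Real.log (g (k + 1)) + Real.log (g k) =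
      Real.log (r (k + 1)) - Real.log (r k) := by
    intro k
    rw [hlogr, hlogr]
    ring
  -- a threshold beyond which `C θ^k ≤ 1/2`
  have hCθ : Tendsto (fun k : ℕ => C * θ ^ k) atTop (𝓝 0) := by
    simpa using (tendsto_pow_atTop_nhds_zero_of_lt_one hθ.le hθ1).const_mul C
  obtain ⟨k₀, hk₀⟩ : ∃ k₀ : ℕ, ∀ k ≥ k₀, C * θ ^ k ≤ 1 / 2 :=
    eventually_atTop.1 (hCθ.eventually (ge_mem_nhds (by norm_num : (0:ℝ) < 1 / 2)))
  -- uniform geometric bound on `|log r k|`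
  let B : ℝ := ∑ i ∈ Finset.range k₀, |Real.log (r i)| / θ ^ i
  have hB0 : 0 ≤ B := Finset.sum_nonneg fun i _ => div_nonneg (abs_nonneg _) (pow_nonneg hθ.le _)
  have hC0 : 0 ≤ C := by
    have h0 := (abs_nonneg _).trans (hr 0)
    simpa using h0
  have hlog_bound : ∀ k, |Real.log (r k)| ≤ (2 * C + B) * θ ^ k := by
    intro k
    have hθk : 0 < θ ^ k := pow_pos hθ k
    rcases lt_or_ge k k₀ with hk | hk
    · have h1 : |Real.log (r k)| / θ ^ k ≤ B :=
        Finset.single_le_sum (f := fun i => |Real.log (r i)| / θ ^ i)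
          (fun i _ => div_nonneg (abs_nonneg _) (pow_nonneg hθ.le _)) (Finset.mem_range.2 hk)
      have h2 : |Real.log (r k)| = |Real.log (r k)| / θ ^ k * θ ^ k := by
        field_simp
      rw [h2]
      have h3 : |Real.log (r k)| / θ ^ k * θ ^ k ≤ B * θ ^ k := mul_le_mul_of_nonneg_right h1 hθk.le
      nlinarith [mul_nonneg hC0 hθk.le]
    · have h1 : |r k - 1| ≤ 1 / 2 := (hr k).trans (hk₀ k hk)
      have h2 : 1 / 2 ≤ r k := by linarith [(abs_le.1 h1).1]
      calc |Real.log (r k)| ≤ 2 * |r k - 1| := abs_log_le_two_mul_abs_sub_one h2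
        _ ≤ 2 * (C * θ ^ k) := by linarith [hr k]
        _ ≤ (2 * C + B) * θ ^ k := by nlinarith [mul_nonneg hB0 hθk.le]
  -- conclusion with `θ' = -log₂ θ`
  refine ⟨-Real.logb 2 θ, 2 * (2 * C + B), ?_, fun k => ?_⟩
  · have : Real.logb 2 θ < 0 := Real.logb_neg one_lt_two hθ hθ1
    linarith
  · have hθk : 0 < θ ^ k := pow_pos hθ k
    have e : ((2:ℝ) ^ k) ^ (-(-Real.logb 2 θ)) = θ ^ k := by
      rw [neg_neg]
      exact (CoerciveSharpnessDimensionPinned.Glue.pow_eq_two_pow_rpow_logb hθ k).symm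
    rw [e]
    show |Real.log (g (k + 2)) - 2 * Real.log (g (k + 1)) + Real.log (g k)| ≤ _
    rw [hsd k]
    have hmono : θ ^ (k + 1) ≤ θ ^ k := pow_le_pow_of_le_one hθ.le hθ1.le (Nat.le_succ k)
    calc |Real.log (r (k + 1)) - Real.log (r k)|
        ≤ |Real.log (r (k + 1))| + |Real.log (r k)| := abs_sub _ _
      _ ≤ (2 * C + B) * θ ^ (k + 1) + (2 * C + B) * θ ^ k := add_le_add (hlog_bound _) (hlog_bound _)
      _ ≤ 2 * (2 * C + B) * θ ^ k := by
          nlinarith [mul_le_mul_of_nonneg_left hmono (by linarith : (0:ℝ) ≤ 2 * C + B)]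

/-- **The torus transfer**: `TorusUniformDyadicRate → DimensionPinned` (the crux of item
stmt-CriticalPhenomena-4662 by name, route decl `CoerciveSharpness.DimensionPinned`), through the landed
pointwise port `stub_pointwiseTransfer`. -/
theorem dimensionPinned_of_torusUniformDyadicRate
    (h : ∃ Δ θ C : ℝ, ∃ A : ℕ, 0 < θ ∧ θ < 1 ∧ 1 ≤ A ∧ ∀ k N : ℕ, A * 2 ^ (k + 1) ≤ N + 1 →
      |isingTorusTwoPoint 3 (N + 1) (criticalBeta 3) 0 (Torus.proj (N + 1) 0)
            (Torus.proj (N + 1) (Pi.single 0 ((2 ^ (k + 1) : ℕ) : ℤ))) * (4 : ℝ) ^ Δ /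
          isingTorusTwoPoint 3 (N + 1) (criticalBeta 3) 0 (Torus.proj (N + 1) 0)
            (Torus.proj (N + 1) (Pi.single 0 ((2 ^ k : ℕ) : ℤ))) - 1| ≤ C * θ ^ k) :
    DimensionPinned :=
  CoerciveSharpnessDimensionPinned.stub_pointwiseTransfer (stub_geometricLawRate (stub_thermodynamicLimit h))

/-- The same, typed as the item's home decl `ClusterRigidity.DimensionPinned`. -/
theorem clusterRigidity_dimensionPinned_of_torusUniformDyadicRate
    (h : ∃ Δ θ C : ℝ, ∃ A : ℕ, 0 < θ ∧ θ < 1 ∧ 1 ≤ A ∧ ∀ k N : ℕ, A * 2 ^ (k + 1) ≤ N + 1 →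
      |isingTorusTwoPoint 3 (N + 1) (criticalBeta 3) 0 (Torus.proj (N + 1) 0)
            (Torus.proj (N + 1) (Pi.single 0 ((2 ^ (k + 1) : ℕ) : ℤ))) * (4 : ℝ) ^ Δ /
          isingTorusTwoPoint 3 (N + 1) (criticalBeta 3) 0 (Torus.proj (N + 1) 0)
            (Torus.proj (N + 1) (Pi.single 0 ((2 ^ k : ℕ) : ℤ))) - 1| ≤ C * θ ^ k) :
    Summit.CriticalPhenomena.Ising3DConformalLimit.Theses.ClusterRigidity.DimensionPinned :=
  dimensionPinned_of_torusUniformDyadicRate h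

/-- The same, typed as `HelsonAxis.EtaBoundsExist`. -/
theorem helsonAxis_etaBoundsExist_of_torusUniformDyadicRate
    (h : ∃ Δ θ C : ℝ, ∃ A : ℕ, 0 < θ ∧ θ < 1 ∧ 1 ≤ A ∧ ∀ k N : ℕ, A * 2 ^ (k + 1) ≤ N + 1 →
      |isingTorusTwoPoint 3 (N + 1) (criticalBeta 3) 0 (Torus.proj (N + 1) 0)
            (Torus.proj (N + 1) (Pi.single 0 ((2 ^ (k + 1) : ℕ) : ℤ))) * (4 : ℝ) ^ Δ /
          isingTorusTwoPoint 3 (N + 1) (criticalBeta 3) 0 (Torus.proj (N + 1) 0)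
            (Torus.proj (N + 1) (Pi.single 0 ((2 ^ k : ℕ) : ℤ))) - 1| ≤ C * θ ^ k) :
    Summit.CriticalPhenomena.Ising3DConformalLimit.Theses.HelsonAxis.EtaBoundsExist :=
  dimensionPinned_of_torusUniformDyadicRate h

/-- **A pointwise geometric law already pins** (infinite-volume form of the dock, no torus):
`(∃ Δ θ C, 0 < θ < 1, ∀ k, |g(2^{k+1}) 4^Δ/g(2^k) − 1| ≤ C θ^k) → DimensionPinned`. -/
theorem dimensionPinned_of_dyadicGeometricLaw
    (h : ∃ Δ θ C : ℝ, 0 < θ ∧ θ < 1 ∧ ∀ k : ℕ,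
      |criticalTwoPoint 3 (Pi.single 0 ((2 ^ (k + 1) : ℕ) : ℤ)) * (4 : ℝ) ^ Δ /
          criticalTwoPoint 3 (Pi.single 0 ((2 ^ k : ℕ) : ℤ)) - 1| ≤ C * θ ^ k) :
    DimensionPinned :=
  CoerciveSharpnessDimensionPinned.stub_pointwiseTransfer (stub_geometricLawRate h)

end Summit.CriticalPhenomena.Ising3DConformalLimit.Theorems.CoerciveSharpnessDimensionPinnedTorusDock
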